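import Mathlib

/-!
# QtameRootData — ALGEBRAIC root data for Eisenstein-type primes over an arbitrary complete DVR

Workfile on crux `TwoVariableEulerSystemDivisibility` (stmt-BirchSwinnertonDyer-20728, route
SignedBaseChange; ideator bsd-idea-14 g22, W-71/W-79 publish-only). PURE ALGEBRA, sorry-free; it proves no
summit statement, no Theses decl and no part of BSD.

PURPOSE — the one non-mechanical step of the owed coefficient-generic re-typing of the qtame engines
(`Door5.md` §2 (G0-ur)(ii)). `QtameDoor5.lean` §E10 builds ROOT DATA (a complete DVR `S`, finite over the
coefficient ring, `char 0`, and a root `u₀ ∈ 𝔪_S` of the Weierstrass polynomial of a good prime) by `p`-ADIC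
ANALYSIS: a splitting field over `ℚ_p` with the spectral norm, `S = O_L`, completeness from COMPACTNESS of
`O_L`. Over the coefficient rings the crux actually needs (`Ŵ′ ⊇ ℤ_p^{ur}`, infinite residue field) `O_L` is
not compact and that construction does not transfer. Door 5 consumes root data ONLY at the members
`P_n = T^{d_n} + ϖ·h_n` (`h_n` a unit) of an Eisenstein system (`QtameDoor5.lean` §E14.7 `classical_dvd`,
`rootDatumS (𝓟.P n)`), whose Weierstrass polynomials are EISENSTEIN. For those, root data are ALGEBRAIC over
ANY complete DVR `𝒪`:

* `isAdicComplete_of_comparable` (§1): adic completeness transfers from an `R`-ideal `I` to an `A`-ideal `J`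
  along an algebra `R → A` when `I·A ≤ J` and `J^d ≤ I·A` (`d ≥ 1`).
* §2: for `f ∈ 𝒪[X]` monic, Eisenstein at `𝔪_𝒪`, of positive degree, `S := AdjoinRoot f = 𝒪[α]` is a domain,
  finite free over `𝒪`, LOCAL with maximal ideal `(α)` (`maximalIdeal_eq_span_root`: every maximal ideal
  contains `𝔪_𝒪·S` by integrality and `α` because `α^d ∈ 𝔪_𝒪·S`; and `ϖ ∈ (α)` because
  `α^d = -ϖ·B` with `B ≡ f(0)/ϖ mod (α)` a unit), hence a DVR (`isDiscreteValuationRing_adjoinRoot`, Mathlib's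
  `IsDiscreteValuationRing.TFAE`), `𝔪_S`-adically complete when `𝒪` is `𝔪_𝒪`-adically complete
  (`(α)^d ≤ 𝔪_𝒪·S ≤ (α)` + `isAdicComplete_of_moduleFinite` (§0, verbatim the tree's `Literature.NumberTheory.Automorphic.isAdicComplete_of_moduleFinite`, restated because that module is not built on the farm) + §1), of characteristic zero when `𝒪`
  is, with `α ∈ 𝔪_S` and `f(α) = 0`.
* `exists_dvr_root_of_isEisensteinAt` (§3): the packaged existence statement in exactly the shape of
  `QtameDoor5.RD.exists_dvr_root` (there: `𝒪 = ℤ_[p]`, `f` merely distinguished), for Eisenstein `f` over any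
  complete DVR; and `exists_dvr_root_of_eisenstein_shape` (§4): the same for the Weierstrass polynomial of a
  power series `P = T^d + C a * h` with `a` a uniformiser, `h` a unit, `d ≥ 1` — the members of an Eisenstein
  system — which is what a coefficient-generic `rootDatumS` needs.

Standard mathematics (Serre, *Local Fields*, I §6 Prop. 17: `𝒪[α]` is a DVR for `α` a root of an Eisenstein
polynomial); written here because Mathlib has the Eisenstein criterion and `AdjoinRoot` but not this
consequence, and because it removes the only analytic step from the (G0-ur) re-typing.
-/

set_option autoImplicit false
set_option linter.dupNamespace false

namespace Summit.BirchSwinnertonDyer.BirchSwinnertonDyer.Cruxes.TwoVariableEulerSystemDivisibility.QtameRootData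

open Polynomial IsLocalRing

universe u

/-! ## 0. Finitely generated modules over complete rings are complete (tree lemma, restated) -/

section ModuleFinite

open Submodule TensorProduct

variable {R M : Type*} [CommRing R] [AddCommGroup M] [Module R M] (I : Ideal R)

/-- A finitely generated module over an `I`-adically precomplete ring is `I`-adically precomplete
(verbatim `Literature.NumberTheory.Automorphic.isPrecomplete_of_moduleFinite`). -/
theorem isPrecomplete_of_moduleFinite [IsPrecomplete I R] [Module.Finite R M] : IsPrecomplete I M := by
  refine AdicCompletion.of_surjective_iff.1 fun y => ?_
  obtain ⟨t, rfl⟩ := AdicCompletion.ofTensorProduct_surjective_of_finite I M y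
  have key : ∀ t : AdicCompletion I R ⊗[R] M, ∃ m : M, t = (1 : AdicCompletion I R) ⊗ₜ[R] m := by
    intro t
    induction t using TensorProduct.induction_on with
    | zero => exact ⟨0, by rw [TensorProduct.tmul_zero]⟩
    | tmul r m =>
      obtain ⟨r₀, rfl⟩ := AdicCompletion.of_surjective I R r
      refine ⟨r₀ • m, ?_⟩
      rw [← TensorProduct.smul_tmul]
      congr 1
      rw [← Algebra.algebraMap_eq_smul_one]
      rfl
    | add t₁ t₂ h₁ h₂ =>
      obtain ⟨m₁, rfl⟩ := h₁
      obtain ⟨m₂, rfl⟩ := h₂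
      exact ⟨m₁ + m₂, by rw [TensorProduct.tmul_add]⟩
  obtain ⟨m, rfl⟩ := key t
  exact ⟨m, by rw [AdicCompletion.ofTensorProduct_tmul, one_smul]⟩

/-- A finitely generated module over an `I`-adically complete Noetherian ring with `I ≤ J(R)` is
`I`-adically complete (verbatim `Literature.NumberTheory.Automorphic.isAdicComplete_of_moduleFinite`). -/
theorem isAdicComplete_of_moduleFinite [IsNoetherianRing R] [IsAdicComplete I R]
    (hI : I ≤ Ideal.jacobson ⊥) [Module.Finite R M] : IsAdicComplete I M :=
  { toIsHausdorff := IsHausdorff.of_le_jacobson I M hI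
    toIsPrecomplete := isPrecomplete_of_moduleFinite I }

end ModuleFinite

/-! ## 1. Transfer of adic completeness along comparable filtrations -/

section Transfer

variable {R : Type*} {A : Type*} [CommRing R] [CommRing A] [Algebra R A]

theorem mem_pow_smul_top_iff (I : Ideal R) (n : ℕ) (x : A) :
    x ∈ (I ^ n • ⊤ : Submodule R A) ↔ x ∈ (I.map (algebraMap R A)) ^ n := by
  rw [Ideal.smul_top_eq_map, Submodule.restrictScalars_mem, Ideal.map_pow]

theorem mem_pow_smul_top_iff' (J : Ideal A) (n : ℕ) (x : A) :
    x ∈ (J ^ n • ⊤ : Submodule A A) ↔ x ∈ J ^ n := by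
  rw [smul_eq_mul, Ideal.mul_top]

/-- **Transfer of adic completeness.** If `A` is `I`-adically complete as an `R`-module and `J` is an
ideal of `A` with `I·A ≤ J` and `J^d ≤ I·A` for some `d ≥ 1`, then `A` is `J`-adically complete. -/
theorem isAdicComplete_of_comparable (I : Ideal R) (J : Ideal A) {d : ℕ} (hd : 1 ≤ d)
    (h1 : I.map (algebraMap R A) ≤ J) (h2 : J ^ d ≤ I.map (algebraMap R A))
    [IsAdicComplete I A] : IsAdicComplete J A where
  haus' x hx := by
    refine IsHausdorff.haus' (I := I) x fun n => ?_
    rw [SModEq.zero, mem_pow_smul_top_iff]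
    have h := hx (d * n)
    rw [SModEq.zero, mem_pow_smul_top_iff', pow_mul] at h
    exact Ideal.pow_right_mono h2 n h
  prec' f hf := by
    have hg : ∀ {m n : ℕ}, m ≤ n →
        f (d * m) ≡ f (d * n) [SMOD (I ^ m • ⊤ : Submodule R A)] := by
      intro m n hmn
      rw [SModEq.sub_mem, mem_pow_smul_top_iff]
      have h := hf (Nat.mul_le_mul_left d hmn)
      rw [SModEq.sub_mem, mem_pow_smul_top_iff', pow_mul] at h
      exact Ideal.pow_right_mono h2 m h
    obtain ⟨L, hL⟩ := IsPrecomplete.prec' (I := I) (fun n => f (d * n)) hg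
    refine ⟨L, fun n => ?_⟩
    rw [SModEq.sub_mem, mem_pow_smul_top_iff']
    have hdn : n ≤ d * n := Nat.le_mul_of_pos_left n hd
    have e1 : f n - f (d * n) ∈ J ^ n := by
      have h := hf hdn
      rwa [SModEq.sub_mem, mem_pow_smul_top_iff'] at h
    have e2 : f (d * n) - L ∈ J ^ n := by
      have h := hL n
      rw [SModEq.sub_mem, mem_pow_smul_top_iff] at h
      exact Ideal.pow_right_mono h1 n h
    have e : f n - L = (f n - f (d * n)) + (f (d * n) - L) := by ring
    rw [e]
    exact add_mem e1 e2

end Transfer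

/-! ## 2. `AdjoinRoot` of an Eisenstein polynomial over a DVR -/

section Eisenstein

variable {𝒪 : Type u} [CommRing 𝒪] [IsDomain 𝒪] [IsDiscreteValuationRing 𝒪]
variable {f : 𝒪[X]}

theorem prime_of_isEisensteinAt (hf : f.Monic) (hE : f.IsEisensteinAt (maximalIdeal 𝒪))
    (hdeg : 0 < f.natDegree) : Prime f :=
  (hE.irreducible inferInstance hf.isPrimitive hdeg).prime

theorem isDomain_adjoinRoot (hf : f.Monic) (hE : f.IsEisensteinAt (maximalIdeal 𝒪))
    (hdeg : 0 < f.natDegree) : IsDomain (AdjoinRoot f) :=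
  AdjoinRoot.isDomain_of_prime (prime_of_isEisensteinAt hf hE hdeg)

theorem of_injective (hf : f.Monic) (hdeg : 0 < f.natDegree) :
    Function.Injective (AdjoinRoot.of f) := by
  apply AdjoinRoot.of.injective_of_degree_ne_zero
  rw [Polynomial.degree_eq_natDegree hf.ne_zero]
  exact_mod_cast hdeg.ne'

/-- `f - X^d = C ϖ * q` with `q(0)` a unit, for `ϖ` a uniformiser. -/
theorem exists_eq_X_pow_add_C_mul (hf : f.Monic) (hE : f.IsEisensteinAt (maximalIdeal 𝒪))
    (hdeg : 0 < f.natDegree) {ϖ : 𝒪} (hϖ : Irreducible ϖ) :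
    ∃ q : 𝒪[X], f = X ^ f.natDegree + C ϖ * q ∧ IsUnit (q.coeff 0) := by
  have hm := hϖ.maximalIdeal_eq
  have hdvd : C ϖ ∣ f - X ^ f.natDegree := by
    rw [Polynomial.C_dvd_iff_dvd_coeff]
    intro i
    rw [Polynomial.coeff_sub, Polynomial.coeff_X_pow]
    rcases lt_trichotomy i f.natDegree with hi | hi | hi
    · rw [if_neg hi.ne, sub_zero]
      have := hE.mem hi
      rw [hm, Ideal.mem_span_singleton] at this
      exact this
    · subst hi
      rw [if_pos rfl, Polynomial.Monic.coeff_natDegree hf, sub_self]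
      exact dvd_zero _
    · rw [if_neg hi.ne', sub_zero, Polynomial.coeff_eq_zero_of_natDegree_lt hi]
      exact dvd_zero _
  obtain ⟨q, hq⟩ := hdvd
  refine ⟨q, by rw [← hq]; ring, ?_⟩
  have h0 : f.coeff 0 = ϖ * q.coeff 0 := by
    have := congrArg (fun r => Polynomial.coeff r 0) hq
    simp only [Polynomial.coeff_sub, Polynomial.coeff_X_pow, Polynomial.coeff_C_mul,
      if_neg (Nat.pos_iff_ne_zero.mp hdeg).symm, sub_zero] at this
    exact this
  have hnot : f.coeff 0 ∉ maximalIdeal 𝒪 ^ 2 := hE.notMem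
  rw [h0] at hnot
  by_contra hu
  apply hnot
  have hq0 : q.coeff 0 ∈ maximalIdeal 𝒪 := by
    rw [mem_maximalIdeal, mem_nonunits_iff]; exact hu
  rw [hm] at hq0 ⊢
  rw [pow_two]
  exact Ideal.mul_mem_mul (Ideal.mem_span_singleton_self ϖ) hq0

omit [IsDomain 𝒪] [IsDiscreteValuationRing 𝒪] in
/-- In `S = 𝒪[α]`: `α^d = -(ϖ · q(α))`. -/
theorem root_pow_eq {ϖ : 𝒪} {q : 𝒪[X]} (hq : f = X ^ f.natDegree + C ϖ * q) :
    AdjoinRoot.root f ^ f.natDegree = -(AdjoinRoot.of f ϖ * AdjoinRoot.mk f q) := by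
  have h : AdjoinRoot.mk f (X ^ f.natDegree + C ϖ * q) = 0 := by
    rw [← hq]; exact AdjoinRoot.mk_self
  rw [map_add, map_pow, map_mul, AdjoinRoot.mk_X, AdjoinRoot.mk_C] at h
  exact eq_neg_of_add_eq_zero_left h

/-- The residue map `S = 𝒪[α] → k = 𝒪/𝔪`, `α ↦ 0` (well defined because `f(0) ∈ 𝔪`). -/
noncomputable def toResidueField (hE : f.IsEisensteinAt (maximalIdeal 𝒪)) (hdeg : 0 < f.natDegree) :
    AdjoinRoot f →+* ResidueField 𝒪 :=
  AdjoinRoot.lift (residue 𝒪) 0 (by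
    rw [Polynomial.eval₂_at_zero, residue_eq_zero_iff]
    exact hE.mem hdeg)

theorem toResidueField_of (hE : f.IsEisensteinAt (maximalIdeal 𝒪)) (hdeg : 0 < f.natDegree) (x : 𝒪) :
    toResidueField hE hdeg (AdjoinRoot.of f x) = residue 𝒪 x :=
  AdjoinRoot.lift_of _

theorem toResidueField_root (hE : f.IsEisensteinAt (maximalIdeal 𝒪)) (hdeg : 0 < f.natDegree) :
    toResidueField hE hdeg (AdjoinRoot.root f) = 0 :=
  AdjoinRoot.lift_root _

theorem toResidueField_mk (hE : f.IsEisensteinAt (maximalIdeal 𝒪)) (hdeg : 0 < f.natDegree)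
    (g : 𝒪[X]) : toResidueField hE hdeg (AdjoinRoot.mk f g) = residue 𝒪 (g.coeff 0) := by
  rw [toResidueField, AdjoinRoot.lift_mk, Polynomial.eval₂_at_zero]

theorem toResidueField_surjective (hE : f.IsEisensteinAt (maximalIdeal 𝒪)) (hdeg : 0 < f.natDegree) :
    Function.Surjective (toResidueField hE hdeg) := fun y => by
  obtain ⟨x, rfl⟩ := Ideal.Quotient.mk_surjective y
  exact ⟨AdjoinRoot.of f x, toResidueField_of hE hdeg x⟩

theorem ker_isMaximal (hE : f.IsEisensteinAt (maximalIdeal 𝒪)) (hdeg : 0 < f.natDegree) :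
    (RingHom.ker (toResidueField hE hdeg)).IsMaximal :=
  RingHom.ker_isMaximal_of_surjective _ (toResidueField_surjective hE hdeg)

/-- The kernel of the residue map is contained in every ideal containing `𝔪_𝒪·S` and `α`. -/
theorem ker_le_of_mem (hE : f.IsEisensteinAt (maximalIdeal 𝒪)) (hdeg : 0 < f.natDegree)
    (N : Ideal (AdjoinRoot f)) (hm : (maximalIdeal 𝒪).map (AdjoinRoot.of f) ≤ N)
    (hα : AdjoinRoot.root f ∈ N) : RingHom.ker (toResidueField hE hdeg) ≤ N := by
  intro x hx
  obtain ⟨g, rfl⟩ := AdjoinRoot.mk_surjective x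
  rw [RingHom.mem_ker, toResidueField_mk, residue_eq_zero_iff] at hx
  have hsplit : AdjoinRoot.mk f g =
      AdjoinRoot.of f (g.coeff 0) + AdjoinRoot.root f * AdjoinRoot.mk f g.divX := by
    conv_lhs => rw [← Polynomial.divX_mul_X_add g]
    rw [map_add, map_mul, AdjoinRoot.mk_X, AdjoinRoot.mk_C]
    ring
  rw [hsplit]
  exact add_mem (hm (Ideal.mem_map_of_mem _ hx)) (Ideal.mul_mem_right _ N hα)

/-- Every maximal ideal of `S` contains `𝔪_𝒪·S` (integrality + locality of `𝒪`). -/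
theorem map_maximalIdeal_le (hf : f.Monic) (N : Ideal (AdjoinRoot f)) [hN : N.IsMaximal] :
    (maximalIdeal 𝒪).map (AdjoinRoot.of f) ≤ N := by
  haveI : Module.Finite 𝒪 (AdjoinRoot f) := hf.finite_adjoinRoot
  rw [Ideal.map_le_iff_le_comap]
  have hmax : (N.comap (algebraMap 𝒪 (AdjoinRoot f))).IsMaximal :=
    Ideal.isMaximal_comap_of_isIntegral_of_isMaximal N
  rw [AdjoinRoot.algebraMap_eq] at hmax
  exact le_of_eq (IsLocalRing.eq_maximalIdeal hmax).symm

/-- Every maximal ideal of `S` contains `α` (because `α^d ∈ 𝔪_𝒪·S`). -/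
theorem root_mem (hf : f.Monic) (hE : f.IsEisensteinAt (maximalIdeal 𝒪)) (hdeg : 0 < f.natDegree)
    (N : Ideal (AdjoinRoot f)) [hN : N.IsMaximal] : AdjoinRoot.root f ∈ N := by
  obtain ⟨ϖ, hϖ⟩ := IsDiscreteValuationRing.exists_irreducible 𝒪
  obtain ⟨q, hq, -⟩ := exists_eq_X_pow_add_C_mul hf hE hdeg hϖ
  apply hN.isPrime.mem_of_pow_mem f.natDegree
  rw [root_pow_eq hq]
  refine neg_mem (Ideal.mul_mem_right _ N (map_maximalIdeal_le hf N ?_))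
  exact Ideal.mem_map_of_mem _ (hϖ.maximalIdeal_eq ▸ Ideal.mem_span_singleton_self ϖ)

theorem existsUnique_isMaximal (hf : f.Monic) (hE : f.IsEisensteinAt (maximalIdeal 𝒪))
    (hdeg : 0 < f.natDegree) : ∃! N : Ideal (AdjoinRoot f), N.IsMaximal := by
  refine ⟨RingHom.ker (toResidueField hE hdeg), ker_isMaximal hE hdeg, fun N hN => ?_⟩
  haveI := hN
  exact ((ker_isMaximal hE hdeg).eq_of_le hN.ne_top
    (ker_le_of_mem hE hdeg N (map_maximalIdeal_le hf N) (root_mem hf hE hdeg N))).symm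

/-- **`S = 𝒪[α]` is local.** -/
theorem isLocalRing_adjoinRoot (hf : f.Monic) (hE : f.IsEisensteinAt (maximalIdeal 𝒪))
    (hdeg : 0 < f.natDegree) : IsLocalRing (AdjoinRoot f) :=
  IsLocalRing.of_unique_max_ideal (existsUnique_isMaximal hf hE hdeg)

theorem maximalIdeal_eq_ker (hf : f.Monic) (hE : f.IsEisensteinAt (maximalIdeal 𝒪))
    (hdeg : 0 < f.natDegree) :
    haveI := isLocalRing_adjoinRoot hf hE hdeg
    maximalIdeal (AdjoinRoot f) = RingHom.ker (toResidueField hE hdeg) := by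
  haveI := isLocalRing_adjoinRoot hf hE hdeg
  exact (IsLocalRing.eq_maximalIdeal (ker_isMaximal hE hdeg)).symm

/-- A uniformiser of `𝒪` lies in `(α)`: `ϖ = -α^d · q(α)⁻¹` with `q(α)` a unit. -/
theorem of_mem_span_root (hf : f.Monic) (hE : f.IsEisensteinAt (maximalIdeal 𝒪))
    (hdeg : 0 < f.natDegree) {ϖ : 𝒪} (hϖ : Irreducible ϖ) :
    AdjoinRoot.of f ϖ ∈ Ideal.span {AdjoinRoot.root f} := by
  haveI := isLocalRing_adjoinRoot hf hE hdeg
  obtain ⟨q, hq, hq0⟩ := exists_eq_X_pow_add_C_mul hf hE hdeg hϖ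
  have hB : IsUnit (AdjoinRoot.mk f q) := by
    by_contra hu
    have hmem : AdjoinRoot.mk f q ∈ maximalIdeal (AdjoinRoot f) :=
      (mem_maximalIdeal _).mpr (mem_nonunits_iff.mpr hu)
    rw [maximalIdeal_eq_ker hf hE hdeg, RingHom.mem_ker, toResidueField_mk, residue_eq_zero_iff] at hmem
    exact ((mem_nonunits_iff).mp ((mem_maximalIdeal _).mp hmem)) hq0
  obtain ⟨u, hu⟩ := hB
  have hpow := root_pow_eq hq
  rw [← hu] at hpow
  have hϖeq : AdjoinRoot.of f ϖ = -(AdjoinRoot.root f ^ f.natDegree) * ↑u⁻¹ := by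
    rw [hpow, neg_neg, mul_assoc, Units.mul_inv, mul_one]
  rw [hϖeq]
  exact Ideal.mul_mem_right _ _
    (neg_mem (Ideal.pow_mem_of_mem _ (Ideal.mem_span_singleton_self _) _ hdeg))

/-- **The maximal ideal of `S = 𝒪[α]` is `(α)`.** -/
theorem maximalIdeal_eq_span_root (hf : f.Monic) (hE : f.IsEisensteinAt (maximalIdeal 𝒪))
    (hdeg : 0 < f.natDegree) :
    haveI := isLocalRing_adjoinRoot hf hE hdeg
    maximalIdeal (AdjoinRoot f) = Ideal.span {AdjoinRoot.root f} := by
  haveI := isLocalRing_adjoinRoot hf hE hdeg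
  obtain ⟨ϖ, hϖ⟩ := IsDiscreteValuationRing.exists_irreducible 𝒪
  apply le_antisymm
  · rw [maximalIdeal_eq_ker hf hE hdeg]
    refine ker_le_of_mem hE hdeg _ ?_ (Ideal.mem_span_singleton_self _)
    rw [hϖ.maximalIdeal_eq, Ideal.map_span, Set.image_singleton, Ideal.span_singleton_le_iff_mem]
    exact of_mem_span_root hf hE hdeg hϖ
  · rw [Ideal.span_singleton_le_iff_mem, maximalIdeal_eq_ker hf hE hdeg, RingHom.mem_ker]
    exact toResidueField_root hE hdeg

theorem maximalIdeal_ne_bot (hf : f.Monic) (hE : f.IsEisensteinAt (maximalIdeal 𝒪))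
    (hdeg : 0 < f.natDegree) :
    haveI := isLocalRing_adjoinRoot hf hE hdeg
    maximalIdeal (AdjoinRoot f) ≠ ⊥ := by
  haveI := isLocalRing_adjoinRoot hf hE hdeg
  obtain ⟨ϖ, hϖ⟩ := IsDiscreteValuationRing.exists_irreducible 𝒪
  intro h
  have hmem : AdjoinRoot.of f ϖ ∈ maximalIdeal (AdjoinRoot f) := by
    rw [maximalIdeal_eq_span_root hf hE hdeg]; exact of_mem_span_root hf hE hdeg hϖ
  rw [h, Ideal.mem_bot] at hmem
  exact hϖ.ne_zero ((injective_iff_map_eq_zero _).mp (of_injective hf hdeg) ϖ hmem)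

/-- **`S = 𝒪[α]` is a discrete valuation ring** (Serre, *Local Fields* I §6 Prop. 17). -/
theorem isDiscreteValuationRing_adjoinRoot (hf : f.Monic) (hE : f.IsEisensteinAt (maximalIdeal 𝒪))
    (hdeg : 0 < f.natDegree) :
    haveI := isDomain_adjoinRoot hf hE hdeg
    IsDiscreteValuationRing (AdjoinRoot f) := by
  haveI := isDomain_adjoinRoot hf hE hdeg
  haveI := isLocalRing_adjoinRoot hf hE hdeg
  have hnf : ¬ IsField (AdjoinRoot f) := by
    rw [IsLocalRing.isField_iff_maximalIdeal_eq]
    exact maximalIdeal_ne_bot hf hE hdeg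
  have hpr : (maximalIdeal (AdjoinRoot f)).IsPrincipal :=
    ⟨⟨AdjoinRoot.root f, by rw [maximalIdeal_eq_span_root hf hE hdeg]⟩⟩
  exact ((IsDiscreteValuationRing.TFAE (AdjoinRoot f) hnf).out 0 4).mpr hpr

/-- **`S = 𝒪[α]` is `𝔪_S`-adically complete** when `𝒪` is `𝔪_𝒪`-adically complete
(`(α)^d ≤ 𝔪_𝒪·S ≤ (α)` and §0–§1). -/
theorem isAdicComplete_adjoinRoot [IsAdicComplete (maximalIdeal 𝒪) 𝒪] (hf : f.Monic)
    (hE : f.IsEisensteinAt (maximalIdeal 𝒪)) (hdeg : 0 < f.natDegree) :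
    haveI := isLocalRing_adjoinRoot hf hE hdeg
    IsAdicComplete (maximalIdeal (AdjoinRoot f)) (AdjoinRoot f) := by
  haveI := isLocalRing_adjoinRoot hf hE hdeg
  haveI : Module.Finite 𝒪 (AdjoinRoot f) := hf.finite_adjoinRoot
  haveI : IsAdicComplete (maximalIdeal 𝒪) (AdjoinRoot f) :=
    isAdicComplete_of_moduleFinite (maximalIdeal 𝒪) (maximalIdeal_le_jacobson ⊥)
  obtain ⟨ϖ, hϖ⟩ := IsDiscreteValuationRing.exists_irreducible 𝒪
  obtain ⟨q, hq, -⟩ := exists_eq_X_pow_add_C_mul hf hE hdeg hϖ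
  refine isAdicComplete_of_comparable (maximalIdeal 𝒪) (maximalIdeal (AdjoinRoot f)) hdeg ?_ ?_
  · rw [AdjoinRoot.algebraMap_eq]
    exact map_maximalIdeal_le hf _
  · rw [AdjoinRoot.algebraMap_eq, maximalIdeal_eq_span_root hf hE hdeg, Ideal.span_singleton_pow,
      Ideal.span_singleton_le_iff_mem, root_pow_eq hq]
    refine neg_mem (Ideal.mul_mem_right _ _ ?_)
    exact Ideal.mem_map_of_mem _ (hϖ.maximalIdeal_eq ▸ Ideal.mem_span_singleton_self ϖ)

end Eisenstein

/-! ## 3. Root data for an Eisenstein polynomial over a complete DVR -/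

section RootData

variable {𝒪 : Type u} [CommRing 𝒪] [IsDomain 𝒪] [IsDiscreteValuationRing 𝒪]

/-- **Algebraic root data.** For a monic Eisenstein `f` of positive degree over a complete DVR `𝒪` of
characteristic zero there is a complete DVR `S`, finite over `𝒪`, of characteristic zero, with a root
`u₀ ∈ 𝔪_S` of `f` — namely `S = 𝒪[X]/(f)`, `u₀ = X`. Same shape as `QtameDoor5.RD.exists_dvr_root`
(`𝒪 = ℤ_[p]`), no `p`-adic analysis. -/
theorem exists_dvr_root_of_isEisensteinAt [IsAdicComplete (maximalIdeal 𝒪) 𝒪] [CharZero 𝒪]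
    (f : 𝒪[X]) (hf : f.Monic) (hE : f.IsEisensteinAt (maximalIdeal 𝒪)) (hdeg : 0 < f.natDegree) :
    ∃ (S : Type u) (_ : CommRing S) (_ : IsDomain S) (_ : IsDiscreteValuationRing S)
      (_ : IsAdicComplete (IsLocalRing.maximalIdeal S) S) (_ : CharZero S) (_ : Algebra 𝒪 S)
      (_ : Module.Finite 𝒪 S) (u₀ : S),
      u₀ ∈ IsLocalRing.maximalIdeal S ∧ f.eval₂ (algebraMap 𝒪 S) u₀ = 0 := by
  haveI := isDomain_adjoinRoot hf hE hdeg
  haveI := isDiscreteValuationRing_adjoinRoot hf hE hdeg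
  haveI := isAdicComplete_adjoinRoot hf hE hdeg
  haveI : CharZero (AdjoinRoot f) :=
    charZero_of_injective_algebraMap ((AdjoinRoot.algebraMap_eq f).symm ▸ of_injective hf hdeg)
  haveI : Module.Finite 𝒪 (AdjoinRoot f) := hf.finite_adjoinRoot
  refine ⟨AdjoinRoot f, inferInstance, inferInstance, inferInstance, inferInstance, inferInstance,
    inferInstance, inferInstance, AdjoinRoot.root f, ?_, ?_⟩
  · rw [maximalIdeal_eq_span_root hf hE hdeg]
    exact Ideal.mem_span_singleton_self _
  · rw [AdjoinRoot.algebraMap_eq]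
    exact AdjoinRoot.eval₂_root f

end RootData


/-! ## 4. Root data for Eisenstein-SHAPE power series `P = T^d + ϖ·h` (Eisenstein-system members) -/

section EisensteinShape

open PowerSeries

variable {𝒪 : Type u} [CommRing 𝒪] [IsDomain 𝒪] [IsDiscreteValuationRing 𝒪]

/-- `P = T^d + ϖ·h` reduces to `T^d ≠ 0` modulo `𝔪`. -/
theorem map_residue_eq_of_eisenstein_shape {ϖ : 𝒪} (hϖ : Irreducible ϖ) {d : ℕ} {h P : 𝒪⟦X⟧}
    (hP : P = PowerSeries.X ^ d + PowerSeries.C ϖ * h) :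
    P.map (residue 𝒪) = PowerSeries.X ^ d := by
  have h0 : residue 𝒪 ϖ = 0 :=
    (residue_eq_zero_iff _).mpr (hϖ.maximalIdeal_eq ▸ Ideal.mem_span_singleton_self ϖ)
  rw [hP, map_add, map_pow, PowerSeries.map_X, map_mul, PowerSeries.map_C, h0, map_zero, zero_mul,
    add_zero]

theorem map_residue_ne_zero_of_eisenstein_shape {ϖ : 𝒪} (hϖ : Irreducible ϖ) {d : ℕ} {h P : 𝒪⟦X⟧}
    (hP : P = PowerSeries.X ^ d + PowerSeries.C ϖ * h) : P.map (residue 𝒪) ≠ 0 := by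
  rw [map_residue_eq_of_eisenstein_shape hϖ hP]
  exact pow_ne_zero _ PowerSeries.X_ne_zero

/-- **The Weierstrass polynomial of `P = T^d + ϖ·h` (`h` a unit, `d ≥ 1`) is Eisenstein of degree `d`.** -/
theorem weierstrassDistinguished_of_eisenstein_shape [IsAdicComplete (maximalIdeal 𝒪) 𝒪]
    {ϖ : 𝒪} (hϖ : Irreducible ϖ) {d : ℕ} (hd : 0 < d) {h P : 𝒪⟦X⟧} (hh : IsUnit h)
    (hP : P = PowerSeries.X ^ d + PowerSeries.C ϖ * h) (hres : P.map (residue 𝒪) ≠ 0) :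
    (P.weierstrassDistinguished hres).natDegree = d ∧
      (P.weierstrassDistinguished hres).IsEisensteinAt (maximalIdeal 𝒪) := by
  have HW := P.isWeierstrassFactorization_weierstrassDistinguished_weierstrassUnit hres
  set f := P.weierstrassDistinguished hres with hfdef
  set u := P.weierstrassUnit hres with hudef
  have hfD : f.IsDistinguishedAt (maximalIdeal 𝒪) := HW.isDistinguishedAt
  have hnat : f.natDegree = d := by
    rw [HW.natDegree_eq_toNat_order_map, map_residue_eq_of_eisenstein_shape hϖ hP,
      PowerSeries.order_X_pow]
    rfl
  refine ⟨hnat, ⟨?_, fun hn => hfD.mem hn, ?_⟩⟩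
  · rw [hfD.monic.leadingCoeff]
    exact (Ideal.ne_top_iff_one _).mp (Ideal.IsMaximal.ne_top inferInstance)
  · -- constant terms: `f(0)·u(0) = ϖ·h(0)` with `u(0), h(0)` units, so `f(0) ∉ (ϖ²)`
    have hc : f.coeff 0 * PowerSeries.constantCoeff u = ϖ * PowerSeries.constantCoeff h := by
      have := congrArg PowerSeries.constantCoeff HW.eq_mul
      rw [map_mul, Polynomial.constantCoeff_coe] at this
      rw [← this, hP, map_add, map_pow, PowerSeries.constantCoeff_X, zero_pow hd.ne', zero_add, map_mul,
        PowerSeries.constantCoeff_C]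
    have hu0 : IsUnit (PowerSeries.constantCoeff u) := PowerSeries.isUnit_iff_constantCoeff.mp HW.isUnit
    have hh0 : IsUnit (PowerSeries.constantCoeff h) := PowerSeries.isUnit_iff_constantCoeff.mp hh
    intro hmem
    rw [hϖ.maximalIdeal_eq, Ideal.span_singleton_pow, Ideal.mem_span_singleton] at hmem
    obtain ⟨t, ht⟩ := hmem
    obtain ⟨v, hv⟩ := hu0
    have hh0mem : PowerSeries.constantCoeff h ∈ maximalIdeal 𝒪 := by
      rw [hϖ.maximalIdeal_eq, Ideal.mem_span_singleton]
      refine ⟨t * ↑v, mul_left_cancel₀ hϖ.ne_zero ?_⟩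
      rw [← hc, ht, ← hv]; ring
    exact (mem_nonunits_iff.mp ((mem_maximalIdeal _).mp hh0mem)) hh0

/-- **Algebraic root data for Eisenstein-system members.** Over a complete DVR `𝒪` of characteristic zero,
for `P = T^d + ϖ·h` (`ϖ` a uniformiser, `h` a unit, `d ≥ 1`) the Weierstrass polynomial `f` of `P` has degree
`d` and there is a complete DVR `S`, finite over `𝒪`, of characteristic zero, with `u₀ ∈ 𝔪_S`, `f(u₀) = 0` —
exactly what a coefficient-generic `rootDatumS (𝓟.P n)` consumes (`P = f·(unit)` then gives `P(u₀) = 0`). -/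
theorem exists_dvr_root_of_eisenstein_shape [IsAdicComplete (maximalIdeal 𝒪) 𝒪] [CharZero 𝒪]
    {ϖ : 𝒪} (hϖ : Irreducible ϖ) {d : ℕ} (hd : 0 < d) {h P : 𝒪⟦X⟧} (hh : IsUnit h)
    (hP : P = PowerSeries.X ^ d + PowerSeries.C ϖ * h) (hres : P.map (residue 𝒪) ≠ 0) :
    (P.weierstrassDistinguished hres).natDegree = d ∧
    ∃ (S : Type u) (_ : CommRing S) (_ : IsDomain S) (_ : IsDiscreteValuationRing S)
      (_ : IsAdicComplete (IsLocalRing.maximalIdeal S) S) (_ : CharZero S) (_ : Algebra 𝒪 S)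
      (_ : Module.Finite 𝒪 S) (u₀ : S),
      u₀ ∈ IsLocalRing.maximalIdeal S ∧
        (P.weierstrassDistinguished hres).eval₂ (algebraMap 𝒪 S) u₀ = 0 := by
  obtain ⟨hnat, hE⟩ := weierstrassDistinguished_of_eisenstein_shape hϖ hd hh hP hres
  exact ⟨hnat, exists_dvr_root_of_isEisensteinAt _
    (P.isDistinguishedAt_weierstrassDistinguished hres).monic hE (hnat ▸ hd)⟩

end EisensteinShape

end Summit.BirchSwinnertonDyer.BirchSwinnertonDyer.Cruxes.TwoVariableEulerSystemDivisibility.QtameRootData
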